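import Summits.HodgeConjecture.HodgeConjecture.Theorems.AmpleAdicLefschetzWeakLefschetzInjective
import Literature.AlgebraicTopology.SingularHomology.RestrictionAcyclicComplement
import HarnessLib

/-!
# Route AmpleAdicLefschetz — crux `ThickDescent` (stmt-HodgeConjecture-2613), stub
# `stub_weakLefschetzSurjective`: the weak Lefschetz theorem, SURJECTIVITY half, in affine-cover form

For `X` smooth projective of dimension `n` over `ℂ`, ANY closed immersion `f : Y ⟶ X` and a finite
set `s` of affine opens of `X` covering exactly `X ∖ f(Y)`, the restriction
`f^* : Hʲ(X(ℂ); ℂ) → Hʲ(Y(ℂ); ℂ)` is SURJECTIVE for `j + |s| + 1 ≤ n` (Voisin II, Thm. 1.23 in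
affine-cover form, surjective direction). This is the mirror image of the tree's landed
`weakLefschetzInjective_proof` (`AmpleAdicLefschetzWeakLefschetzInjective`), with the same three
steps, all PROVED in the tree:

* (AF) + (MV) `isZero_singularHomology_ptsOver_biUnion_of_andreottiFrankel` fed with
  `andreottiFrankel_affineOpen`: `H_q((X ∖ Y)(ℂ); ℂ) = 0` for `q ≥ n + |s|` (Andreotti–Frankel for the
  affine opens, Voisin II Thm. 1.22, and Mayer–Vietoris);
* (D) `surjective_complexBettiMap_of_isZero_compl_range_of_locallyContractibleSpace` — the duality
  step, surjective direction: `K = f(Y(ℂ)) ≅ Y(ℂ)` is compact (`Y` is proper) and locally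
  contractible (`locallyContractibleSpace_complexPoints_of_isSmoothProjective`, the triangulability of
  complex projective algebraic sets), hence taut in the closed oriented `2n`-manifold `X(ℂ)`
  (`Cech.RetractionNhds.nonempty_of_locallyContractibleSpace`), so `H_{q-1}(X(ℂ) ∖ K) = 0` with
  `q = 2n - j` gives the surjectivity of `Hʲ(X(ℂ)) → Hʲ(K) ≅ Hʲ(Y(ℂ))`
  (`singularCohomology.map_subtypeVal_surjective_of_isZero_compl`); the needed vanishing degree is
  `q - 1 = 2n - j - 1 ≥ n + |s|`, i.e. `j + |s| + 1 ≤ n`.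

No named fact is introduced.

## References

* [VoisinHodgeII2003] C. Voisin, Hodge Theory and Complex Algebraic Geometry II (CUP 2003), §1.2.2
  Thm. 1.22, Thm. 1.23 and its proof (1.7)–(1.9) (PDF pp. 59–61).
* [Milnor1963] J. Milnor, Morse theory (1963), §7 Thm. 7.2.
* [HatcherAT2002] A. Hatcher, Algebraic Topology (2002), Thm. 2.16, §2.2 p. 149.
* [Spanier1981] E. H. Spanier, Algebraic Topology, Ch. 6 §1 Thm. 10 (tautness).
-/

noncomputable section

-- every declaration of this problem lives in `Summit.HodgeConjecture.HodgeConjecture.…` (summit = sub-problem)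
set_option linter.dupNamespace false

namespace Summit.HodgeConjecture.HodgeConjecture.Theorems

open CategoryTheory CategoryTheory.Limits AlgebraicGeometry
open Literature.AlgebraicGeometry Literature.AlgebraicGeometry.Motives Literature.AlgebraicGeometry.HodgeTheory
open Literature.AlgebraicTopology.SingularHomology Literature.Geometry.Kaehler
open Literature.AlgebraicTopology.Homotopy _root_.Topology

/-! ### The duality step for an arbitrary closed subscheme, surjective direction -/

/-- **Lefschetz surjectivity from the vanishing of the homology of the complement, for an arbitrary
closed subscheme** (Voisin II, proof of Thm. 1.23, (1.7)–(1.9), surjective direction): `X` smooth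
projective of dimension `m`, `f : Y ⟶ X` a closed immersion over `ℂ` with `K = f(Y(ℂ)) ⊆ X(ℂ)`
locally contractible, `k + j = 2m`, `j' + 1 = j` and `H_{j'}(X(ℂ) ∖ K; ℂ) = 0`; then
`f^* : Hᵏ(X(ℂ); ℂ) → Hᵏ(Y(ℂ); ℂ)` is surjective. Proof: that of the tree's
`injective_complexBettiMap_of_isZero_compl_range_of_locallyContractibleSpace` verbatim — `K ≅ Y(ℂ)` is
compact (`Y` is proper, being closed in the proper `X`), taut by
`Cech.RetractionNhds.nonempty_of_locallyContractibleSpace` — with Čech–Lefschetz duality in the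
surjective direction, `singularCohomology.map_subtypeVal_surjective_of_isZero_compl`.
[cite: VoisinHodgeII2003, §1.2.2 proof of Thm. 1.23, (1.7)–(1.9) (PDF pp. 60–61)]
[cite: Spanier1981, Ch. 6 §1 Thm. 10] -/
theorem surjective_complexBettiMap_of_isZero_compl_range_of_locallyContractibleSpace {m : ℕ}
    {X Y : SchemeOver ℂ} (hX : IsSmoothProjective m X) (f : Y ⟶ X) [IsClosedImmersion f.left]
    (hKl : LocallyContractibleSpace ↥(Set.range (AlgPoints.map (L := ℂ) f)))
    {k j j' : ℕ} (hkj : k + j = 2 * m) (hj : j' + 1 = j)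
    (hAF : IsZero (singularHomology ℂ ℂ ↥(Set.range (AlgPoints.map (L := ℂ) f))ᶜ j')) :
    Function.Surjective (complexBetti.map f k) := by
  classical
  letI := hX.chartedSpace
  haveI := ComplexPoints.compactSpace_of_isSmoothProjective hX
  haveI := ComplexPoints.t2Space_of_isSmoothProjective hX
  let μ : HomologicalOrientation ℂ (ComplexPoints X) (2 * m) :=
    Classical.choice (ComplexPoints.isOrientableOver ℂ hX)
  -- `Y` is proper over `ℂ` (closed in the proper `X`), so `Y(ℂ)` is compact
  haveI : IsProper X.hom := IsSmoothProjective.isProper_holds hX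
  haveI : IsProper Y.hom := by rw [← Over.w f]; infer_instance
  haveI : CompactSpace (ComplexPoints Y) := compactSpace_algPoints_of_isProper_holds Y ℂ
  have hemb : IsEmbedding (AlgPoints.map (L := ℂ) f) :=
    AlgPoints.isEmbedding_map_of_isClosedImmersion f
  set K : Set (ComplexPoints X) := Set.range (AlgPoints.map (L := ℂ) f) with hKdef
  have hKc : IsCompact K := isCompact_range hemb.continuous
  obtain ⟨N, g, hg⟩ := Literature.Geometry.Manifold.exists_isClosedEmbedding_pi_of_compactSpace
    (M := ComplexPoints X) (EuclideanSpace ℝ (Fin (2 * m)))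
  have hNR : IsNeighbourhoodRetract (Set.range g) :=
    isNeighbourhoodRetract_range_of_compactSpace
      isNeighbourhoodRetract_of_locallyContractibleSpace_holds (EuclideanSpace ℝ (Fin (2 * m)))
      hg.isEmbedding
  obtain ⟨T⟩ := Cech.RetractionNhds.nonempty_of_locallyContractibleSpace hg.isEmbedding hNR hKc hKl
  have hsurj := singularCohomology.map_subtypeVal_surjective_of_isZero_compl μ hKc.isClosed T
    (p := k) (q := j) (q' := j') hkj hj hAF
  have hfac : AlgPoints.mapContinuous (L := ℂ) f =
      (⟨Subtype.val, continuous_subtype_val⟩ : C(↥K, ComplexPoints X)).comp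
        (hemb.toHomeomorph : C(ComplexPoints Y, ↥K)) := rfl
  change Function.Surjective (singularCohomology.map ℂ ℂ (AlgPoints.mapContinuous (L := ℂ) f) k)
  rw [hfac, singularCohomology.map_comp]
  exact ((forget (ModuleCat ℂ)).mapIso
    (singularCohomology.mapIso ℂ ℂ hemb.toHomeomorph k)).toEquiv.bijective.2.comp hsurj

/-! ### The stub -/

/-- **Weak Lefschetz, surjectivity half, affine-cover form** (stub `stub_weakLefschetzSurjective` of
the crux `ThickDescent`; Voisin II Thm. 1.23, surjective direction): for `X` smooth projective of
dimension `n` over `ℂ`, ANY closed immersion `f : Y ⟶ X` and a finite set `s` of affine opens of `X`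
covering exactly `X ∖ f(Y)`, the restriction `f^* : Hʲ(X(ℂ); ℂ) → Hʲ(Y(ℂ); ℂ)` is surjective for
`j + |s| + 1 ≤ n`. Proof: `H_q((X ∖ Y)(ℂ); ℂ) = 0` for `q ≥ n + |s|`
(`isZero_singularHomology_ptsOver_biUnion_of_andreottiFrankel` with `andreottiFrankel_affineOpen`:
Andreotti–Frankel for the affine opens and Mayer–Vietoris), `K = f(Y(ℂ))` is compact and locally
contractible (`locallyContractibleSpace_complexPoints_of_isSmoothProjective`), hence taut, and the
duality step `surjective_complexBettiMap_of_isZero_compl_range_of_locallyContractibleSpace` with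
`q - 1 = 2n - j - 1 ≥ n + |s|`. [cite: VoisinHodgeII2003, §1.2.2 Thm. 1.22–1.23 (PDF pp. 59–61)] -/
theorem stub_weakLefschetzSurjective :
    ∀ ⦃n : ℕ⦄ ⦃X Y : SchemeOver ℂ⦄ (f : Y ⟶ X), IsSmoothProjective n X → IsClosedImmersion f.left →
      ∀ (s : Finset X.left.Opens), (∀ U ∈ s, IsAffineOpen U) →
      (⋃ U ∈ s, (U : Set X.left)) = (Set.range f.left.base)ᶜ →
      ∀ (j : ℕ), j + s.card + 1 ≤ n → Function.Surjective (complexBetti.map f j) := by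
  intro n X Y f hX hf s hs hcov j hj
  haveI := hf
  have hset : Set.range (AlgPoints.map (L := ℂ) f) =
      {P : ComplexPoints X | P.pt ∈ Set.range f.left.base} :=
    Set.ext fun P => AlgPoints.mem_range_map_iff_pt_mem f P
  -- the complement of `K = f(Y(ℂ))` is the set of complex points over `⋃ s`
  have hK : (Set.range (AlgPoints.map (L := ℂ) f))ᶜ =
      {P : ComplexPoints X | P.pt ∈ ⋃ V ∈ s, (V : Set X.left)} := by
    rw [hset, hcov]
    ext P
    simp
  -- (AF) + (MV): `H_{2n-j-1}((X ∖ Y)(ℂ); ℂ) = 0` since `2n - j - 1 ≥ n + |s|`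
  have hvan : IsZero (singularHomology ℂ ℂ ↥(Set.range (AlgPoints.map (L := ℂ) f))ᶜ
      (2 * n - j - 1)) := by
    rw [hK]
    exact isZero_singularHomology_ptsOver_biUnion_of_andreottiFrankel hX
      (andreottiFrankel_affineOpen hX) s hs (by omega)
  -- (LC): `f(Y(ℂ)) = Z(ℂ)` for the Zariski-closed `Z = f(Y)` is locally contractible
  have hKl : LocallyContractibleSpace ↥(Set.range (AlgPoints.map (L := ℂ) f)) := by
    rw [hset]
    exact locallyContractibleSpace_complexPoints_of_isSmoothProjective hX _
      f.left.isClosedEmbedding.isClosed_range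
  -- (D): duality, surjective direction, with `q = 2n - j`, `q - 1 = 2n - j - 1`
  exact surjective_complexBettiMap_of_isZero_compl_range_of_locallyContractibleSpace hX f hKl
    (k := j) (j := 2 * n - j) (j' := 2 * n - j - 1) (by omega) (by omega) hvan

end Summit.HodgeConjecture.HodgeConjecture.Theorems

end
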